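import Summits.CriticalPhenomena.PercolationContinuityZ3.Theorems.PercNearOneGluingNoHeavyConstsThreePointDiamond
import Literature.Probability.Percolation.FourFunctionsProdBernoulli
import HarnessLib

/-!
# The three-point diamond `P(ac|b)·P(bc|a) ≤ P(abc)·P(a|b|c)` is a four-functions inequality — PROVED
# (PAPER-2 track (ii): constants of the CSH family; seat `prim-consts-2`, gen 19)

builds on p205010 (kernel theorem, internal audit signed; external expert review pending).  Support file (`--supports
stmt-CriticalPhenomena-4575`); memo `run/shared/lean/prim/consts/FROM-prim-consts-2-g19-*.md`.  Theorems only; no sorries; standard axioms.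

Both statements typed as open conjectures in `…ConstsThreePointDiamond.lean` (gen 18),
* `Consts.ThreePointDiamond`:  `P(a↔c, c↮b)·P(b↔c, c↮a) ≤ P(a↔c, b↔c)·P(c↮a, c↮b, a↮b)`, and
* `Consts.ThreePointDiamondTwoSource`:  `P(S₁↔a, S₁↮b)·P(S₂↔b, S₂↮a) ≤ P(S₁∪S₂↔a, S₁∪S₂↔b)·P(S₁∩S₂↮a, S₁∩S₂↮b, a↮b)`,
are instances of the Ahlswede–Daykin four functions theorem for the (log-modular) product measure `prodBernoulli w`
(Bollobás–Riordan, *Percolation*, Ch. 2 Thm. 7 and eq. (14); in the tree `Literature.Probability.Percolation.prodBernoulli_fourEvents`):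
if `ω ∈ {S₁↔a, S₁↮b}` and `ω' ∈ {S₂↔b, S₂↮a}` then
* the JOIN `ω ∪ ω'` contains an `ω`-path from `S₁` to `a` and an `ω'`-path from `S₂` to `b`, so `ω ∪ ω' ∈ {S₁∪S₂↔a} ∩ {S₁∪S₂↔b}`;
* the MEET `ω ∩ ω'` lies below `ω'` (so no `s ∈ S₂` reaches `a`) and below `ω` (so no `s ∈ S₁` reaches `b`), and — the "rider" — `a ↮ b` in
  `ω ∩ ω'`, because already in `ω` the vertex `a` lies in the cluster of some `s₁ ∈ S₁` while `b` does not.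
So the rider `a ↮ b`, which no conditional-association inequality of van den Berg–Häggström–Kahn produces, comes for free from the lattice
structure: it is inherited by the meet from ONE of the two factors.  The one-source statement is the case `S₁ = S₂ = {c}` (also proved directly,
for an arbitrary finite vertex type: `Consts.threePointDiamond_ineq`).  Consequently `P(abc)·P(a|b|c) ≥` the product of any two of
`P(ab|c), P(ac|b), P(bc|a)`, with equality on series configurations; this is the lower-bound companion of Gladkov's Conjecture 10.1
(an UPPER bound on `P(abc)P(a|b|c) − P(ac|b)P(a|bc)` when `P(ab|c)` is small), not a proof of it.
The one-source inequality was landed independently the same afternoon by seat `prim-l12-p1` (gen 22) with a different proof — concavity of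
the diamond margin along every edge weight, `ThreePointDiamondAnyEdge.diamond_all` / `diamond_cells` (no correlation inequality); this file gives
the four-functions proof, the TWO-SOURCE theorem, and closes the typed statements `Consts.ThreePointDiamond`, `Consts.ThreePointDiamondTwoSource` by name.
[cite: BollobasRiordan2006, Ch. 2 Thm. 7 (Four Functions Theorem) and eq. (14)] [cite: AhlswedeDaykin1978]
[cite: VandenbergKahn2001, Thm. 1.2 (p. 123)] [cite: Gladkov2024, Conjecture 10.1 (p. 18)]
-/

noncomputable section

namespace Summit.CriticalPhenomena.PercolationContinuityZ3.Theorems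

open MeasureTheory Set Literature.Probability.LatticeModels Literature.Probability.Percolation
open scoped Classical

namespace Consts

variable {V : Type*} [Fintype V]

/-- **THEOREM (three-point diamond, every finite vertex type).**  For `μ = prodBernoulli w` and vertices `a, b, c`:
`μ(c↔a, c↮b) · μ(c↔b, c↮a) ≤ μ(c↔a, c↔b) · μ(c↮a, c↮b, a↮b)`, i.e. `P(ac|b)·P(bc|a) ≤ P(abc)·P(a|b|c)`.
Proof: Ahlswede–Daykin four events (`prodBernoulli_fourEvents`) — a configuration of `ac|b` and one of `bc|a` MEET in `a|b|c`
(the rider `a↮b` is inherited from the first, where `a ∈ C_c ∌ b`) and JOIN in `abc`.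
[cite: BollobasRiordan2006, Ch. 2 Thm. 7 and eq. (14) — corollary, derived here] -/
theorem threePointDiamond_ineq (w : Sym2 V → unitInterval) (a b c : V) :
    (prodBernoulli w).real (openConn c a ∩ (openConn c b)ᶜ) * (prodBernoulli w).real (openConn c b ∩ (openConn c a)ᶜ) ≤
      (prodBernoulli w).real (openConn c a ∩ openConn c b) *
        (prodBernoulli w).real ((openConn c a)ᶜ ∩ (openConn c b)ᶜ ∩ (openConn a b)ᶜ) := by
  rw [mul_comm ((prodBernoulli w).real (openConn c a ∩ openConn c b))]
  refine prodBernoulli_fourEvents w _ _ _ _ fun ω hω ω' hω' => ?_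
  have mem : ∀ (η : BondConfig V) (u v : V), η ∈ (openConn u v : Set (BondConfig V)) ↔ (openGraph η).Reachable u v :=
    fun _ _ _ => Iff.rfl
  simp only [mem_inter_iff, mem_compl_iff, mem] at hω hω' ⊢
  obtain ⟨hca, hcb⟩ := hω
  obtain ⟨hcb', hca'⟩ := hω'
  refine ⟨⟨⟨fun h => hca' (h.mono (BHK2006.openGraph_le inter_subset_right)),
      fun h => hcb (h.mono (BHK2006.openGraph_le inter_subset_left))⟩,
      fun h => hcb (hca.trans (h.mono (BHK2006.openGraph_le inter_subset_left)))⟩,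
    hca.mono (BHK2006.openGraph_le subset_union_left), hcb'.mono (BHK2006.openGraph_le subset_union_right)⟩

/-- **THEOREM (two-source diamond, every finite vertex type).**  For `μ = prodBernoulli w`, vertex sets `S₁, S₂` and vertices `a, b`:
`μ(S₁↔a, S₁↮b) · μ(S₂↔b, S₂↮a) ≤ μ(S₁∪S₂↔a, S₁∪S₂↔b) · μ(S₁∩S₂↮a, S₁∩S₂↮b, a↮b)`.
Proof: Ahlswede–Daykin four events — the join keeps the two connections (union on the source side), the meet keeps the avoidances of
the common sources (intersection) and inherits `a↮b` from the first factor (`a` is joined to some `s₁ ∈ S₁`, `b` to none).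
[cite: BollobasRiordan2006, Ch. 2 Thm. 7 and eq. (14) — corollary, derived here] -/
theorem threePointDiamondTwoSource_ineq (w : Sym2 V → unitInterval) (S₁ S₂ : Set V) (a b : V) :
    (prodBernoulli w).real ((⋃ s ∈ S₁, openConn s a) ∩ {ω | ∀ s ∈ S₁, ¬ (openGraph ω).Reachable s b}) *
        (prodBernoulli w).real ((⋃ s ∈ S₂, openConn s b) ∩ {ω | ∀ s ∈ S₂, ¬ (openGraph ω).Reachable s a}) ≤
      (prodBernoulli w).real ((⋃ s ∈ S₁ ∪ S₂, openConn s a) ∩ (⋃ s ∈ S₁ ∪ S₂, openConn s b)) *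
        (prodBernoulli w).real ({ω | ∀ s ∈ S₁ ∩ S₂, ¬ (openGraph ω).Reachable s a ∧ ¬ (openGraph ω).Reachable s b} ∩
          (openConn a b)ᶜ) := by
  rw [mul_comm ((prodBernoulli w).real ((⋃ s ∈ S₁ ∪ S₂, openConn s a) ∩ (⋃ s ∈ S₁ ∪ S₂, openConn s b)))]
  refine prodBernoulli_fourEvents w _ _ _ _ fun ω hω ω' hω' => ?_
  have mem : ∀ (η : BondConfig V) (u v : V), η ∈ (openConn u v : Set (BondConfig V)) ↔ (openGraph η).Reachable u v :=
    fun _ _ _ => Iff.rfl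
  simp only [mem_inter_iff, mem_compl_iff, mem_iUnion, mem_setOf_eq, mem] at hω hω' ⊢
  obtain ⟨⟨s₁, hs₁, h1a⟩, h1b⟩ := hω
  obtain ⟨⟨s₂, hs₂, h2b⟩, h2a⟩ := hω'
  refine ⟨⟨fun s hs => ⟨fun h => h2a s hs.2 (h.mono (BHK2006.openGraph_le inter_subset_right)),
      fun h => h1b s hs.1 (h.mono (BHK2006.openGraph_le inter_subset_left))⟩,
      fun h => h1b s₁ hs₁ (h1a.trans (h.mono (BHK2006.openGraph_le inter_subset_left)))⟩,
    ⟨s₁, Or.inl hs₁, h1a.mono (BHK2006.openGraph_le subset_union_left)⟩,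
    ⟨s₂, Or.inr hs₂, h2b.mono (BHK2006.openGraph_le subset_union_right)⟩⟩

/-- **`Consts.ThreePointDiamond` HOLDS** (typed as an open conjecture in gen 18; it is an Ahlswede–Daykin four-events inequality).
[cite: BollobasRiordan2006, Ch. 2 Thm. 7 and eq. (14) — corollary, derived here] -/
theorem threePointDiamond_holds : ThreePointDiamond := fun _n w a b c => threePointDiamond_ineq w a b c

/-- **`Consts.ThreePointDiamondTwoSource` HOLDS** (typed as an open conjecture in gen 18; Ahlswede–Daykin four events).
[cite: BollobasRiordan2006, Ch. 2 Thm. 7 and eq. (14) — corollary, derived here] -/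
theorem threePointDiamondTwoSource_holds : ThreePointDiamondTwoSource := fun _n w S₁ S₂ a b =>
  threePointDiamondTwoSource_ineq w S₁ S₂ a b

end Consts

end Summit.CriticalPhenomena.PercolationContinuityZ3.Theorems

end
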